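import Summits.HodgeConjecture.HodgeConjecture.Theorems.K2E3WittBoundedCartanNormalForm   -- (this seat) P0b: `exists_boundedCartan_sorted`; brings ★ p856917 (the letter `hrawΩ`)
import Summits.HodgeConjecture.HodgeConjecture.Theorems.K2E3WittCartanTameRamified         -- ★ p856370 (K2E3-p09): §1 the cone identity `prod_wittCoweight_pow_inl ∕ inr_inl ∕ inr_inr`
import HarnessLib

/-!
# The `hG` letter of the 13a set-currency driver: the Cartan decomposition of `U(σ, wittFormOn e Han)(K)` OVER THE WITT CONE through the compact set `Ω_b`,
# for EVERY anisotropic kernel and EVERY isometric involution (crux H413, U12-g ∕ 13a road A, file P1)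

Cell `hodgecm-mathlib`, Track B «K2-LIT», crux item `stmt-HodgeConjecture-24833` (h413), socket U12-g `sig_K2E3LocalIrrepAdmissible`, 13a road A (set currency,
RULINGS #14∕#15); seat K2E3-p10 (g4), line lead.  THEOREMS ONLY; count-neutral helper (`--supports stmt-HodgeConjecture-24833 --as helper`).

The bounded twin of ★ p856701 `K2E3WittCartanOfRawCartan` (`K₀` currency, `W = J₀`): from the sorted diagonal normal form P0b `exists_boundedCartan_sorted`
(`k₁ g k₂ = diag(d)`, `σ(d_i) d_{rev i} = 1`, `d ≡ 1` on the kernel, `v(d_k) = exp(−E_k)`, `E` antitone, `k^{±1} ≤ exp b`) the torus part splits as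
`diag(d) = diag(w) · ∏_α a_α(ϖ)^{n α}` with `n α = E(e_α) − E(e_{α+1}) ≥ 0` (★ p856370 §1, the cone identity for ANY `m` and ANY `σϖ`) and `w` a UNIT diagonal with
`σ(w_i) w_{rev i} = 1`, `w ≡ 1` on the kernel — an element of `U` with entries of valuation `≤ 1` (§1).  Hence

* §2 **`exists_boundedSet_mul_cone_mul`** — ONE `b : ℕ` such that every `g ∈ U(σ, wittFormOn e Han)` is `k₁ · ∏_α a_α(ϖ)^{n α} · k₂ · z` with `k₁, k₂` in the
  compact set `Ω_{b′} = {k ∈ U : v(k_{ij}) ≤ exp b′ ∧ v(k⁻¹_{ij}) ≤ exp b′}` for every `b′ ≥ b`, `n : Fin r → ℕ`, `z = 1 ∈ Z(U)` — LITERALLY the `hG` binder of ★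
  p856653 `isAdmissible_irrClass_of_wittCartan_compactSet` with `Ω := Ω_{b′}` (compact by ★ `K2E3WittBoundedCartanPackage.isCompact_boundedSet`) and
  `ϖ := Units.mk0 ϖ _`.

HONEST LABEL: structure theorem; HC_CM is proved only modulo the 7 printed citations (2 remaining named inputs: hLiu418 = stmt-HodgeConjecture-24832, h413 =
stmt-HodgeConjecture-24833) until rung 0 closes; 13a is ★ at odd `N` only.

References: [BruhatTits1972] F. Bruhat, J. Tits, *Groupes réductifs sur un corps local I*, Publ. Math. IHÉS 41 (1972), (4.4.3); [Tits1979] J. Tits, *Reductive groups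
over local fields*, PSPM 33.1 (1979), §3.3.3; [Casselman1995] W. Casselman, *Introduction to the theory of admissible representations of p-adic reductive groups*
(1995), Thm. 5.3.1; [Borel1991] A. Borel, *Linear Algebraic Groups* (1991), §23.
-/

set_option autoImplicit false
-- the mandated namespace repeats `HodgeConjecture.HodgeConjecture`, as in every `Theorems/*.lean` of this sub-problem
set_option linter.dupNamespace false

noncomputable section

open scoped Valued WithZero Matrix MatrixGroups
open Matrix

namespace Summit.HodgeConjecture.HodgeConjecture.Cruxes.H413.K2E3WittCartanOfBoundedCartan

open Literature.NumberTheory.Automorphic Literature.NumberTheory.Automorphic.UnitaryGroup Literature.NumberTheory.Automorphic.HermitianLattice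
open Literature.NumberTheory.Automorphic.CartanUnique
open K2E3LocalUnitaryWitt K2E3WittConeContraction K2E3WittCartanUnramified K2E3WittLeviConeCentreKernel K2E3WittFrameTools K2E3WittCartanTameRamified
  K2E3WittBoundedCartanNormalForm

variable {K : Type*} [Field K] (σ : K →+* K) {N r m : ℕ} (e : WittIndex r m ≃ Fin N)
  (hstd : ∀ x, (e x).val = Sum.elim (fun i : Fin r => i.val) (Sum.elim (fun u : Fin m => r + u.val) (fun j : Fin r => r + m + j.val)) x)
  (Han : Matrix (Fin m) (Fin m) K)

/-! ## §1 Diagonal elements of `U(σ, wittFormOn e Han)` -/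

section Diagonal

include hstd in
/-- **A diagonal matrix `diag(w)` with `σ(w_i) · w_{rev i} = 1` and `w ≡ 1` on the kernel slots is unitary for the Witt form** (any kernel `Han`): the non-zero entries of
`W = wittFormOn e Han` sit at `(p, rev p)` for frame slots `p` and inside the kernel block. [cite: Borel1991, §23] [cite: BruhatTits1972, (4.4.3)] -/
theorem diagonalGL_mem_unitaryGroupOfForm_witt (w : Fin N → Kˣ) (hw : ∀ i, σ (w i : K) * w (Fin.rev i) = 1)
    (hwk : ∀ u : Fin m, w (e (Sum.inr (Sum.inl u))) = 1) : diagonalGL (Fin N) K w ∈ unitaryGroupOfForm σ (wittFormOn e Han) := by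
  refine glDiagonal_mem_unitaryGroupOfForm σ (wittFormOn e Han) w fun a c hac => ?_
  by_cases ha : ∀ u : Fin m, a ≠ e (Sum.inr (Sum.inl u))
  · rw [wittFormOn_apply_of_frame e hstd Han ha] at hac
    have hc : c = Fin.rev a := by by_contra h; exact hac (if_neg h)
    rw [hc]; exact hw a
  · push Not at ha
    obtain ⟨u, rfl⟩ := ha
    by_cases hc : ∀ u' : Fin m, c ≠ e (Sum.inr (Sum.inl u'))
    · exact absurd (wittFormOn_kernel_frame e Han u hc) hac
    · push Not at hc
      obtain ⟨u', rfl⟩ := hc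
      rw [hwk, hwk, Units.val_one, map_one, mul_one]

variable [Valued K ℤᵐ⁰]

/-- The entries of `diag(w)` have valuation `≤ 1` when every `w_i` is a unit of `𝒪`. [cite: Tits1979, §3.3.3] -/
theorem v_diagonalGL_apply_le_one {w : Fin N → Kˣ} (hw1 : ∀ i, Valued.v (w i : K) = 1) (i j : Fin N) :
    Valued.v (((diagonalGL (Fin N) K w : GL (Fin N) K) : Matrix (Fin N) (Fin N) K) i j) ≤ 1 := by
  rw [coe_diagonalGL, Matrix.diagonal_apply]
  split_ifs
  · rw [hw1]
  · rw [map_zero]; exact zero_le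

/-- The entries of `diag(w)⁻¹ = diag(w⁻¹)` have valuation `≤ 1` when every `w_i` is a unit of `𝒪`. [cite: Tits1979, §3.3.3] -/
theorem v_diagonalGL_inv_apply_le_one {w : Fin N → Kˣ} (hw1 : ∀ i, Valued.v (w i : K) = 1) (i j : Fin N) :
    Valued.v ((((diagonalGL (Fin N) K w)⁻¹ : GL (Fin N) K) : Matrix (Fin N) (Fin N) K) i j) ≤ 1 := by
  rw [← map_inv, coe_diagonalGL, Matrix.diagonal_apply]
  split_ifs
  · rw [Pi.inv_apply, Units.val_inv_eq_inv_val, map_inv₀, hw1, inv_one]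
  · rw [map_zero]; exact zero_le

end Diagonal

/-! ## §2 The Cartan decomposition over the Witt cone through `Ω_b` -/

section Cartan

variable [Valued K ℤᵐ⁰] {σ}

include hstd in
/-- **THE `hG` LETTER OF ★ p856653 — the Cartan decomposition of `U(σ, wittFormOn e Han)(K)` over the Witt cone through the compact set `Ω_b`, for EVERY anisotropic kernel
and EVERY isometric involution** (`𝒪[K]` compact, `ϖ` a uniformiser, `e` standard): ONE `b : ℕ` such that for every `b′ ≥ b` every `g ∈ U` is
`k₁ · ∏_α a_α(ϖ)^{n α} · k₂ · z` with `k₁, k₂ ∈ Ω_{b′} = {k ∈ U : v(k_{ij}) ≤ exp b′ ∧ v(k⁻¹_{ij}) ≤ exp b′}`, `n : Fin r → ℕ`, `z = 1 ∈ Z(U)`.  From P0b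
`exists_boundedCartan_sorted` and the split `diag(d) = diag(w) · ∏_α a_α(ϖ)^{n α}` (★ p856370 §1; `diag(w) ∈ U` a unit diagonal, §1).
[cite: BruhatTits1972, (4.4.3)] [cite: Tits1979, §3.3.3] [cite: Casselman1995, Thm. 5.3.1] [cite: Borel1991, §23] -/
theorem exists_boundedSet_mul_cone_mul [CompactSpace 𝒪[K]] {ϖ : K} (hϖ : Valued.v ϖ = WithZero.exp (-1 : ℤ)) (hσ : ∀ x, σ (σ x) = x)
    (hvσ : ∀ x, Valued.v (σ x) = Valued.v x) (hHanh : (Han.map σ)ᵀ = Han) (han : ∀ z : Fin m → K, hermForm σ Han z z = 0 → z = 0) :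
    ∃ b : ℕ, ∀ b' : ℕ, b ≤ b' → ∀ g : unitaryGroupOfForm σ (wittFormOn e Han),
      ∃ k₁ ∈ {k : unitaryGroupOfForm σ (wittFormOn e Han) |
        (∀ i j, Valued.v (((k : GL (Fin N) K) : Matrix (Fin N) (Fin N) K) i j) ≤ WithZero.exp (b' : ℤ)) ∧
        ∀ i j, Valued.v ((((k⁻¹ : unitaryGroupOfForm σ (wittFormOn e Han)) : GL (Fin N) K) : Matrix (Fin N) (Fin N) K) i j) ≤ WithZero.exp (b' : ℤ)},
      ∃ k₂ ∈ {k : unitaryGroupOfForm σ (wittFormOn e Han) |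
        (∀ i j, Valued.v (((k : GL (Fin N) K) : Matrix (Fin N) (Fin N) K) i j) ≤ WithZero.exp (b' : ℤ)) ∧
        ∀ i j, Valued.v ((((k⁻¹ : unitaryGroupOfForm σ (wittFormOn e Han)) : GL (Fin N) K) : Matrix (Fin N) (Fin N) K) i j) ≤ WithZero.exp (b' : ℤ)},
      ∃ n : Fin r → ℕ, ∃ z ∈ Subgroup.center ↥(unitaryGroupOfForm σ (wittFormOn e Han)),
        g = k₁ * Finset.univ.noncommProd (fun α => wittCocharacter σ hσ e Han α (Units.mk0 ϖ (uniformizer_ne_zero hϖ)) ^ n α)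
          (fun α _ β _ _ => (commute_wittCocharacter σ e hσ Han α β (Units.mk0 ϖ (uniformizer_ne_zero hϖ))
            (Units.mk0 ϖ (uniformizer_ne_zero hϖ))).pow_pow (n α) (n β)) * k₂ * z := by
  classical
  have hϖ0 : ϖ ≠ 0 := uniformizer_ne_zero hϖ
  have hσϖ0 : σ ϖ ≠ 0 := (map_ne_zero σ).2 hϖ0
  obtain ⟨b, hb⟩ := exists_boundedCartan_sorted e hstd Han hϖ hσ hvσ hHanh han
  refine ⟨b, fun b' hbb' g => ?_⟩
  have hmono : WithZero.exp (b : ℤ) ≤ WithZero.exp (b' : ℤ) := exp_natCast_le_exp_natCast hbb'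
  have hone : (1 : ℤᵐ⁰) ≤ WithZero.exp (b' : ℤ) := by rw [← WithZero.exp_zero]; exact WithZero.exp_le_exp.2 (by positivity)
  obtain ⟨k₁, k₂, hk₁, hk₁i, hk₂, hk₂i, d, E, hdiag, hdn, hdker, hdv, hanti'⟩ := hb g
  have hd0 : ∀ i, d i ≠ 0 := fun i h0 => by
    have h1 := hdn (Fin.rev i)
    rw [Fin.rev_rev, h0, mul_zero] at h1
    exact zero_ne_one h1
  -- the exponents in the orientation of ★ p856370 §1: `a := -E`... no: `v (d k) = exp (-E k)` means `d ~ ϖ^{E}`; the cone identity wants `b` with `diag = ϖ^b`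
  have hanti : Antitone E := fun i j hij => hanti' i j hij
  have hErev : ∀ p, E (Fin.rev p) = -E p := fun p => by
    have h1 := congrArg Valued.v (hdn p)
    rw [map_mul, hvσ, map_one, hdv, hdv, ← WithZero.exp_add, ← WithZero.exp_zero, WithZero.exp_inj] at h1
    omega
  have hEker : ∀ u : Fin m, E (e (Sum.inr (Sum.inl u))) = 0 := fun u => by
    have h1 := hdv (e (Sum.inr (Sum.inl u)))
    rw [hdker, map_one, ← WithZero.exp_zero, WithZero.exp_inj] at h1
    omega
  -- the cone element and its diagonal `D₀`
  set n : Fin r → ℕ := fun α =>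
    ((if h : α.val < r then E (e (Sum.inl ⟨α.val, h⟩)) else 0) - (if h : α.val + 1 < r then E (e (Sum.inl ⟨α.val + 1, h⟩)) else 0)).toNat
    with hn_def
  set C : ↥(unitaryGroupOfForm σ (wittFormOn e Han)) :=
    Finset.univ.noncommProd (fun α => wittCocharacter σ hσ e Han α (Units.mk0 ϖ hϖ0) ^ n α)
      (fun α _ β _ _ => (commute_wittCocharacter σ e hσ Han α β (Units.mk0 ϖ hϖ0) (Units.mk0 ϖ hϖ0)).pow_pow (n α) (n β)) with hC_def
  set D₀ : Fin N → K := fun k =>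
    Sum.elim (fun _ : Fin r => ϖ ^ E k) (Sum.elim (fun _ : Fin m => (1 : K)) (fun _ : Fin r => σ ϖ ^ E k)) (e.symm k) with hD₀_def
  have hD₀_inl : ∀ i : Fin r, D₀ (e (Sum.inl i)) = ϖ ^ E (e (Sum.inl i)) := fun i => by
    rw [hD₀_def]; dsimp only; rw [e.symm_apply_apply, Sum.elim_inl]
  have hD₀_mid : ∀ u : Fin m, D₀ (e (Sum.inr (Sum.inl u))) = 1 := fun u => by
    rw [hD₀_def]; dsimp only; rw [e.symm_apply_apply, Sum.elim_inr, Sum.elim_inl]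
  have hD₀_inr : ∀ j : Fin r, D₀ (e (Sum.inr (Sum.inr j))) = σ ϖ ^ E (e (Sum.inr (Sum.inr j))) := fun j => by
    rw [hD₀_def]; dsimp only; rw [e.symm_apply_apply, Sum.elim_inr, Sum.elim_inr]
  -- (i) the cone identity: the matrix of `C` is `diag(D₀)` (★ p856370 §1, any `m`, any `σϖ`)
  have hcone : ∀ k, (∏ α : Fin r, ((wittCoweight σ α (Units.mk0 ϖ hϖ0) (e.symm k) : Kˣ) : K) ^ n α) = D₀ k := by
    intro k
    obtain ⟨x, rfl⟩ := e.surjective k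
    rw [e.symm_apply_apply]
    rcases x with i | u | j
    · rw [hD₀_inl]; exact prod_wittCoweight_pow_inl σ e hstd hanti hErev hϖ0 i
    · rw [hD₀_mid]; exact prod_wittCoweight_pow_inr_inl σ (Units.mk0 ϖ hϖ0) n u
    · rw [hD₀_inr]; exact prod_wittCoweight_pow_inr_inr σ e hstd hanti hErev hϖ0 j
  have hCmat : (((C : ↥(unitaryGroupOfForm σ (wittFormOn e Han))) : GL (Fin N) K) : Matrix (Fin N) (Fin N) K) = Matrix.diagonal D₀ := by
    rw [hC_def, coe_noncommProd_wittCocharacter_pow]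
    exact congrArg Matrix.diagonal (funext hcone)
  -- (ii) `D₀ k ≠ 0`, `v (D₀ k) = exp (-E k)`, `σ(D₀ k) · D₀ (rev k) = 1`
  have hD0 : ∀ k, D₀ k ≠ 0 := by
    intro k
    obtain ⟨x, rfl⟩ := e.surjective k
    rcases x with i | u | j
    · rw [hD₀_inl]; exact zpow_ne_zero _ hϖ0
    · rw [hD₀_mid]; exact one_ne_zero
    · rw [hD₀_inr]; exact zpow_ne_zero _ hσϖ0
  have hvD : ∀ k, Valued.v (D₀ k) = WithZero.exp (-E k) := by
    intro k
    obtain ⟨x, rfl⟩ := e.surjective k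
    rcases x with i | u | j
    · rw [hD₀_inl, v_uniformizer_zpow hϖ]
    · rw [hD₀_mid, map_one, hEker u, neg_zero, WithZero.exp_zero]
    · rw [hD₀_inr, map_zpow₀, hvσ, ← map_zpow₀, v_uniformizer_zpow hϖ]
  have hDn : ∀ k, σ (D₀ k) * D₀ (Fin.rev k) = 1 := by
    intro k
    obtain ⟨x, rfl⟩ := e.surjective k
    rcases x with i | u | j
    · rw [hD₀_inl, rev_apply_inl e hstd i, hD₀_inr, ← rev_apply_inl e hstd i, hErev, map_zpow₀, ← zpow_add₀ hσϖ0, add_neg_cancel, zpow_zero]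
    · rw [hD₀_mid, rev_apply_inr_inl' e hstd u, hD₀_mid, map_one, mul_one]
    · rw [hD₀_inr, rev_apply_inr_inr e hstd j, hD₀_inl, ← rev_apply_inr_inr e hstd j, hErev, map_zpow₀, hσ, ← zpow_add₀ hϖ0, add_neg_cancel, zpow_zero]
  -- (iii) the unit diagonal `w = d / D₀`
  obtain ⟨w, hw_def⟩ : ∃ w : Fin N → Kˣ, w = fun k => Units.mk0 (d k / D₀ k) (div_ne_zero (hd0 k) (hD0 k)) := ⟨_, rfl⟩
  have hwval : ∀ k, (w k : K) = d k / D₀ k := fun k => by rw [hw_def]; rfl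
  have hw1 : ∀ k, Valued.v (w k : K) = 1 := fun k => by
    rw [hwval, map_div₀, hdv, hvD, div_self WithZero.coe_ne_zero]
  have hwn : ∀ k, σ (w k : K) * w (Fin.rev k) = 1 := fun k => by
    rw [hwval, hwval, map_div₀, div_mul_div_comm, hdn, hDn, div_one]
  have hwk : ∀ u : Fin m, w (e (Sum.inr (Sum.inl u))) = 1 := fun u => Units.ext (by rw [hwval, hdker, hD₀_mid, div_one, Units.val_one])
  have hWmem : diagonalGL (Fin N) K w ∈ unitaryGroupOfForm σ (wittFormOn e Han) := diagonalGL_mem_unitaryGroupOfForm_witt σ e hstd Han w hwn hwk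
  set Wu : ↥(unitaryGroupOfForm σ (wittFormOn e Han)) := ⟨diagonalGL (Fin N) K w, hWmem⟩ with hWu_def
  have hWuval : ((Wu : ↥(unitaryGroupOfForm σ (wittFormOn e Han))) : GL (Fin N) K) = diagonalGL (Fin N) K w := rfl
  -- (iv) the matrix identities in `GL_N(K)`
  obtain ⟨dU, hdU_def⟩ : ∃ dU : Fin N → Kˣ, dU = fun i => Units.mk0 (d i) (hd0 i) := ⟨_, rfl⟩
  have hX : ((k₁ * g * k₂ : ↥(unitaryGroupOfForm σ (wittFormOn e Han))) : GL (Fin N) K) = diagonalGL (Fin N) K dU := by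
    refine Units.ext ?_
    rw [hdiag, coe_diagonalGL, hdU_def]
    rfl
  have hsplit : diagonalGL (Fin N) K dU = diagonalGL (Fin N) K w * (C : GL (Fin N) K) := by
    refine Units.ext ?_
    rw [Units.val_mul, coe_diagonalGL, coe_diagonalGL, hCmat, Matrix.diagonal_mul_diagonal]
    refine congrArg Matrix.diagonal (funext fun k => ?_)
    rw [hwval, div_mul_cancel₀ _ (hD0 k), hdU_def]
    rfl
  have hXU : k₁ * g * k₂ = Wu * C := Subtype.ext (by rw [hX, hsplit, Subgroup.coe_mul, hWuval])
  have hg : g = (k₁⁻¹ * Wu) * C * k₂⁻¹ * 1 := by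
    rw [mul_one]
    calc g = k₁⁻¹ * (k₁ * g * k₂) * k₂⁻¹ := by group
      _ = k₁⁻¹ * (Wu * C) * k₂⁻¹ := by rw [hXU]
      _ = (k₁⁻¹ * Wu) * C * k₂⁻¹ := by group
  -- (v) the bounds
  have hWb : ∀ i j, Valued.v (((Wu : GL (Fin N) K) : Matrix (Fin N) (Fin N) K) i j) ≤ 1 := fun i j => by
    rw [hWuval]; exact v_diagonalGL_apply_le_one hw1 i j
  have hWib : ∀ i j, Valued.v ((((Wu⁻¹ : ↥(unitaryGroupOfForm σ (wittFormOn e Han))) : GL (Fin N) K) : Matrix (Fin N) (Fin N) K) i j) ≤ 1 := fun i j => by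
    rw [Subgroup.coe_inv, hWuval]; exact v_diagonalGL_inv_apply_le_one hw1 i j
  refine ⟨k₁⁻¹ * Wu, ⟨fun i j => ?_, fun i j => ?_⟩, k₂⁻¹, ⟨fun i j => (hk₂i i j).trans hmono, fun i j => ?_⟩, n, 1, Subgroup.one_mem _, hg⟩
  · rw [Subgroup.coe_mul, Units.val_mul]
    exact (v_mul_apply_le hk₁i hWb i j).trans (by rw [mul_one]; exact hmono)
  · rw [_root_.mul_inv_rev, inv_inv, Subgroup.coe_mul, Units.val_mul]
    exact (v_mul_apply_le hWib hk₁ i j).trans (by rw [one_mul]; exact hmono)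
  · rw [inv_inv]; exact (hk₂ i j).trans hmono

end Cartan

end Summit.HodgeConjecture.HodgeConjecture.Cruxes.H413.K2E3WittCartanOfBoundedCartan

end
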